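import Summits.Ventures.PercRepro.Night2LocalD3TwoOneC

/-!
# PercRepro — the cell `(a, k) = (1, 1)` at `|E ∖ G| = 3`, `q = 4`: **`load2_le_cap2_one_one`** (night-2, gen 13)

At a far set `S` whose only coloop is the coloop `y` of `M|G` (`coloops S = K`): `S` has no layer-1 preimage, so `cap₂(S) = capS(S) ≥ 7/10`;
`|S| = 6`, the five non-coloops span the rank-`4` space `G ∖ y`; the members carrying weight are the pair members `S ∖ P`.

* **three fat pair members inside one covering set `S ∖ t` are impossible** (`not_three_fat_in_erase_one`): their intersection `I`
  has `≤ 2` elements and contains `K`, and a point of `G ∖ S` in `cl I` would raise the rank of `I`;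
* hence a covering set carries at most two fat requests: `L₁(S ∖ t) ≤ 2 · 6/25 + 2 · 1/5 = 22/25`, loss fraction `≤ 9/44`,
  `w₂ ≤ 27/275` (fat) resp. `9/220` (thin);
* the double count `2 · #fat = Σ_t #{fat B : t ∉ B} ≤ 5 · 2` gives `#fat ≤ 5`; with `#ex2 ≤ 10`:
  `load₂ ≤ 10 · 9/220 + 5 · (27/275 − 9/220) = 153/220 ≤ 7/10 ≤ cap₂`.
-/

open scoped Matroid

namespace PercRepro.Shadow

open Finset PerFlat ThmH

variable {α : Type*} [DecidableEq α] {M : Matroid α} [M.Finite]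

section OneOne

variable {G S : Finset α}

open scoped Classical in
/-- **Three fat pair members inside one covering set are impossible** when `coloops S = K` has one element and `|S| = 6`. -/
theorem not_three_fat_in_erase_one (hs : ∀ e ∈ gr M, ∀ f ∈ gr M, e ≠ f → rkN M {e, f} = 2)
    (hl : ∀ e ∈ gr M, M.Indep {e}) (hG : G ∈ flatsQ M (4 + 1)) (hk : kColoops M G = 1)
    (hS : S ∈ shadowAt M (4 + 2) 4 (Uq M (4 + 2) 4) G) (hS6 : S.card = 6)
    (hcol : coloops M S = G.filter (fun y => y ∉ clF M (G.erase y))) {t : α} (ht : t ∈ nonColoops M S)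
    (hP : ∃ p ∈ G, p ∉ S) {B₁ B₂ B₃ : Finset α}
    (hc₁ : coloops M S ⊆ B₁) (hc₂ : coloops M S ⊆ B₂) (hc₃ : coloops M S ⊆ B₃)
    (h₁ : B₁ ⊆ S.erase t) (h₂ : B₂ ⊆ S.erase t) (h₃ : B₃ ⊆ S.erase t)
    (hk₁ : (S \ B₁).card = 2) (hk₂ : (S \ B₂).card = 2) (hk₃ : (S \ B₃).card = 2)
    (h12 : B₁ ≠ B₂) (h13 : B₁ ≠ B₃) (h23 : B₂ ≠ B₃)
    (hf₁ : G \ S ⊆ clF M B₁) (hf₂ : G \ S ⊆ clF M B₂) (hf₃ : G \ S ⊆ clF M B₃) : False := by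
  set K := G.filter (fun y => y ∉ clF M (G.erase y)) with hKdef
  have hGg : G ⊆ gr M := (mem_flatsQ.1 hG).1
  have hSG : S ⊆ G := subset_of_mem_shadowAt hS
  have hI : M.Indep ((S.erase t : Finset α) : Set α) := indep_erase_of_mem_nonColoops hG hS hS6 ht
  have hKc : K.card = 1 := by unfold kColoops at hk; rw [← hKdef] at hk; exact hk
  have htB : ∀ {B : Finset α}, B ⊆ S.erase t → t ∉ B := fun hB h => (Finset.mem_erase.1 (hB h)).1 rfl
  -- the intersection `I` has at most two elements: `S ∖ I` contains `t` and the three other points of the pairs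
  set I := B₁ ∩ B₂ ∩ B₃ with hIdef
  have hIS : I ⊆ S := fun e he => (Finset.mem_erase.1 (h₁ (Finset.mem_inter.1 (Finset.mem_inter.1 he).1).1)).2
  have hKI : K ⊆ I := fun e he =>
    Finset.mem_inter.2 ⟨Finset.mem_inter.2 ⟨hc₁ (hcol ▸ he), hc₂ (hcol ▸ he)⟩, hc₃ (hcol ▸ he)⟩
  have hpt : ∀ {B : Finset α}, B ⊆ S.erase t → (S \ B).card = 2 → ((S \ B).erase t).card = 1 := by
    intro B hB hk'
    rw [Finset.card_erase_of_mem (Finset.mem_sdiff.2 ⟨(mem_nonColoops.1 ht).1, htB hB⟩), hk']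
  obtain ⟨t₁, ht₁⟩ := Finset.card_eq_one.1 (hpt h₁ hk₁)
  obtain ⟨t₂, ht₂⟩ := Finset.card_eq_one.1 (hpt h₂ hk₂)
  obtain ⟨t₃, ht₃⟩ := Finset.card_eq_one.1 (hpt h₃ hk₃)
  have hmem : ∀ {B : Finset α} {u : α}, (S \ B).erase t = {u} → u ∈ S \ B ∧ u ≠ t := by
    intro B u hu
    have : u ∈ (S \ B).erase t := by rw [hu]; exact Finset.mem_singleton_self u
    exact ⟨(Finset.mem_erase.1 this).2, (Finset.mem_erase.1 this).1⟩
  have hpair : ∀ {B : Finset α} {u : α}, B ⊆ S.erase t → (S \ B).card = 2 → (S \ B).erase t = {u} → S \ B = {t, u} := by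
    intro B u hB hk' hu
    have htm : t ∈ S \ B := Finset.mem_sdiff.2 ⟨(mem_nonColoops.1 ht).1, htB hB⟩
    rw [← Finset.insert_erase htm, hu]
  have hne : ∀ {B B' : Finset α} {u u' : α}, B ⊆ S → B' ⊆ S → S \ B = {t, u} → S \ B' = {t, u'} → B ≠ B' → u ≠ u' := by
    intro B B' u u' hB hB' hu hu' hBB' huu'
    apply hBB'
    calc B = S \ (S \ B) := (Finset.sdiff_sdiff_eq_self hB).symm
      _ = S \ (S \ B') := by rw [hu, hu', huu']
      _ = B' := Finset.sdiff_sdiff_eq_self hB'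
  have hS₁ : B₁ ⊆ S := h₁.trans (Finset.erase_subset _ _)
  have hS₂ : B₂ ⊆ S := h₂.trans (Finset.erase_subset _ _)
  have hS₃ : B₃ ⊆ S := h₃.trans (Finset.erase_subset _ _)
  have h12' : t₁ ≠ t₂ := hne hS₁ hS₂ (hpair h₁ hk₁ ht₁) (hpair h₂ hk₂ ht₂) h12
  have h13' : t₁ ≠ t₃ := hne hS₁ hS₃ (hpair h₁ hk₁ ht₁) (hpair h₃ hk₃ ht₃) h13
  have h23' : t₂ ≠ t₃ := hne hS₂ hS₃ (hpair h₂ hk₂ ht₂) (hpair h₃ hk₃ ht₃) h23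
  have hout : insert t {t₁, t₂, t₃} ⊆ S \ I := by
    intro u hu
    simp only [Finset.mem_insert, Finset.mem_singleton] at hu
    rw [Finset.mem_sdiff, hIdef, Finset.mem_inter, Finset.mem_inter]
    rcases hu with rfl | rfl | rfl | rfl
    · exact ⟨(mem_nonColoops.1 ht).1, fun h => htB h₁ h.1.1⟩
    · exact ⟨(Finset.mem_sdiff.1 (hmem ht₁).1).1, fun h => (Finset.mem_sdiff.1 (hmem ht₁).1).2 h.1.1⟩
    · exact ⟨(Finset.mem_sdiff.1 (hmem ht₂).1).1, fun h => (Finset.mem_sdiff.1 (hmem ht₂).1).2 h.1.2⟩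
    · exact ⟨(Finset.mem_sdiff.1 (hmem ht₃).1).1, fun h => (Finset.mem_sdiff.1 (hmem ht₃).1).2 h.2⟩
  have hcard4 : (insert t {t₁, t₂, t₃} : Finset α).card = 4 := by
    rw [Finset.card_insert_of_notMem, Finset.card_insert_of_notMem, Finset.card_pair h23']
    · rw [Finset.mem_insert, Finset.mem_singleton]; rintro (h | h); exact h12' h; exact h13' h
    · simp only [Finset.mem_insert, Finset.mem_singleton]
      rintro (h | h | h)
      · exact (hmem ht₁).2 h.symm
      · exact (hmem ht₂).2 h.symm
      · exact (hmem ht₃).2 h.symm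
  have hI2 : I.card ≤ 2 := by
    have := Finset.card_le_card hout
    have := Finset.card_sdiff_add_card_eq_card hIS
    omega
  -- a point of `G ∖ S` lies in `cl I`, which raises the rank of `I`
  obtain ⟨p, hpG, hpS⟩ := hP
  have hp : p ∈ G \ S := Finset.mem_sdiff.2 ⟨hpG, hpS⟩
  have hp12 : p ∈ clF M (B₁ ∩ B₂) := mem_clF_inter_of_indep hI h₁ h₂ (hf₁ hp) (hf₂ hp)
  have hpI : p ∈ clF M I := mem_clF_inter_of_indep hI (Finset.inter_subset_left.trans h₁) h₃ hp12 (hf₃ hp)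
  have hIG : I ⊆ G := hIS.trans hSG
  have hrle : rkN M (insert p I) ≤ rkN M I := rkN_insert_le_of_mem_clF (hIG.trans hGg) hpI
  -- `ρ(I) = |K| + ρ(I ∖ K)` and `ρ(I ∪ {p}) = |K| + ρ((I ∖ K) ∪ {p})`
  have hY : ∀ y ∈ K, y ∈ G ∧ y ∉ clF M (G.erase y) := fun y hy => Finset.mem_filter.1 hy
  have hpK : p ∉ K := fun h => hpS (coloops_subset_self S (hcol ▸ h))
  have hsplit : I = K ∪ (I \ K) := (Finset.union_sdiff_of_subset hKI).symm
  have hsplit' : insert p I = K ∪ (insert p (I \ K)) := by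
    rw [hsplit]
    ext e
    simp only [Finset.mem_insert, Finset.mem_union, Finset.mem_sdiff]
    tauto
  have h1 := eRk_union_coloops hGg K hY (X := I \ K) (Finset.sdiff_subset.trans hIG) Finset.disjoint_sdiff
  have h2 := eRk_union_coloops hGg K hY (X := insert p (I \ K))
    (Finset.insert_subset hpG (Finset.sdiff_subset.trans hIG))
    (by rw [Finset.disjoint_insert_right]; exact ⟨hpK, Finset.disjoint_sdiff⟩)
  rw [eRk_eq_rkN, eRk_eq_rkN] at h1 h2
  have h1' : rkN M (K ∪ (I \ K)) = K.card + rkN M (I \ K) := by exact_mod_cast h1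
  have h2' : rkN M (K ∪ insert p (I \ K)) = K.card + rkN M (insert p (I \ K)) := by exact_mod_cast h2
  have e1 : rkN M (insert p I) = K.card + rkN M (insert p (I \ K)) := by
    rw [← h2']; congr 1
  have e2 : rkN M I = K.card + rkN M (I \ K) := by
    rw [← h1']; congr 1
  rw [e1, e2] at hrle
  -- `I ∖ K` has at most one element; `insert p (I ∖ K)` is independent
  have hIK1 : (I \ K).card ≤ 1 := by
    have := Finset.card_sdiff_add_card_eq_card hKI
    omega
  have hrIK : rkN M (I \ K) ≤ (I \ K).card := rkN_le_card _
  have hrp : rkN M (insert p (I \ K)) = (I \ K).card + 1 := by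
    have hpnot : p ∉ I \ K := fun h => hpS (hIS (Finset.mem_sdiff.1 h).1)
    rcases Nat.le_one_iff_eq_zero_or_eq_one.1 hIK1 with h0 | h1
    · rw [Finset.card_eq_zero] at h0
      rw [h0, Finset.insert_empty, rkN_eq_card_of_indep (by rw [Finset.coe_singleton]; exact hl p (hGg hpG)),
        Finset.card_singleton, Finset.card_empty]
    · obtain ⟨s, hs'⟩ := Finset.card_eq_one.1 h1
      have hsmem : s ∈ I \ K := by rw [hs']; exact Finset.mem_singleton_self s
      have hsG : s ∈ G := hIG (Finset.mem_sdiff.1 hsmem).1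
      have hps : p ≠ s := fun h => hpnot (h ▸ hsmem)
      rw [hs', Finset.card_singleton]
      have : insert p ({s} : Finset α) = {p, s} := rfl
      rw [this, hs p (hGg hpG) s (hGg hsG) hps]
  omega

open scoped Classical in
/-- At `coloops S = K`, the layer-1 request at a covering set `S ∖ v` is `≤ 4/5 + n/25` when at most `n` of the four pair
deletions `(S ∖ v) ∖ t` are fat members. -/
theorem L1_erase_le_one_one (hG : G ∈ flatsQ M (4 + 1)) (hd : (gr M \ G).card = 3)
    (hS : S ∈ shadowAt M (4 + 2) 4 (Uq M (4 + 2) 4) G) (hS6 : S.card = 6) (ha : (coloops M S).card = 1)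
    (hcol : coloops M S = G.filter (fun y => y ∉ clF M (G.erase y))) {v : α} (hv : v ∈ nonColoops M S)
    (hSv : S.erase v ∈ shadowAt M (4 + 2) 4 (Uq M (4 + 2) 4) G) {n : ℕ}
    (hn : (((nonColoops M S).erase v).filter (fun t => (S.erase v).erase t ∈ membersIn M (Uq M (4 + 2) 4) G ∧
      G \ S ⊆ clF M ((S.erase v).erase t))).card ≤ n) :
    L1 M 4 G (S.erase v) ≤ 4 / 5 + (n : ℚ) / 25 := by
  set K := G.filter (fun y => y ∉ clF M (G.erase y)) with hKdef
  have hT4 : ((nonColoops M S).erase v).card = 4 := by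
    have hT5 : (nonColoops M S).card = 5 := by
      have := Finset.card_sdiff_add_card_eq_card (coloops_subset_self (M := M) S)
      unfold nonColoops; omega
    rw [Finset.card_erase_of_mem hv, hT5]
  refine (L1_le_sum_erase hG hd hSv).trans ?_
  have hset : (S.erase v) \ K = (nonColoops M S).erase v := by
    ext e
    rw [Finset.mem_sdiff, Finset.mem_erase, Finset.mem_erase, mem_nonColoops, hcol]
    constructor
    · rintro ⟨⟨hev, heS⟩, heK⟩
      exact ⟨hev, heS, heK⟩
    · rintro ⟨hev, heS, heK⟩
      exact ⟨⟨hev, heS⟩, heK⟩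
  rw [hset]
  have h2 : ∀ t ∈ (nonColoops M S).erase v,
      (if (S.erase v).erase t ∈ membersIn M (Uq M (4 + 2) 4) G then req M 4 ((S.erase v).erase t) else 0) ≤
        1 / 5 + (if ((S.erase v).erase t ∈ membersIn M (Uq M (4 + 2) 4) G ∧ G \ S ⊆ clF M ((S.erase v).erase t))
          then (1 / 25 : ℚ) else 0) := by
    intro t ht
    rw [Finset.mem_erase] at ht
    obtain ⟨hc, hsub, hcard⟩ := pair_shape_of_erase_erase' hv ht.2 (Ne.symm ht.1)
    by_cases hm : (S.erase v).erase t ∈ membersIn M (Uq M (4 + 2) 4) G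
    · rw [if_pos hm]
      by_cases hf : G \ S ⊆ clF M ((S.erase v).erase t)
      · rw [if_pos ⟨hm, hf⟩]
        have := (req_pair_le' hG hd hS hS6 hm hc hsub hcard).1
        linarith
      · rw [if_neg (fun h => hf h.2)]
        have := (req_pair_le' hG hd hS hS6 hm hc hsub hcard).2.1 hf
        linarith
    · rw [if_neg hm]
      split_ifs <;> norm_num
  calc ∑ t ∈ (nonColoops M S).erase v,
        (if (S.erase v).erase t ∈ membersIn M (Uq M (4 + 2) 4) G then req M 4 ((S.erase v).erase t) else 0)
      ≤ ∑ t ∈ (nonColoops M S).erase v, (1 / 5 + (if ((S.erase v).erase t ∈ membersIn M (Uq M (4 + 2) 4) G ∧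
          G \ S ⊆ clF M ((S.erase v).erase t)) then (1 / 25 : ℚ) else 0)) := Finset.sum_le_sum h2
    _ = 4 / 5 + (1 / 25) * ((((nonColoops M S).erase v).filter (fun t =>
          (S.erase v).erase t ∈ membersIn M (Uq M (4 + 2) 4) G ∧ G \ S ⊆ clF M ((S.erase v).erase t))).card : ℚ) := by
        rw [Finset.sum_add_distrib, Finset.sum_const, hT4, Finset.sum_ite, Finset.sum_const_zero, add_zero,
          Finset.sum_const, nsmul_eq_mul, nsmul_eq_mul]
        push_cast
        ring
    _ ≤ 4 / 5 + (n : ℚ) / 25 := by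
        have : ((((nonColoops M S).erase v).filter (fun t => (S.erase v).erase t ∈ membersIn M (Uq M (4 + 2) 4) G ∧
            G \ S ⊆ clF M ((S.erase v).erase t))).card : ℚ) ≤ n := by exact_mod_cast hn
        linarith

open scoped Classical in
/-- **THE CELL `(a, k) = (1, 1)` AT `|E ∖ G| = 3`, `q = 4`**: every far set whose only coloop is the coloop of `M|G` satisfies
`load₂(S) ≤ cap₂(S)`. -/
theorem load2_le_cap2_one_one (hs : ∀ e ∈ gr M, ∀ f ∈ gr M, e ≠ f → rkN M {e, f} = 2) (hl : ∀ e ∈ gr M, M.Indep {e})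
    (hG : G ∈ flatsQ M (4 + 1)) (hd : (gr M \ G).card = 3) (hk : kColoops M G = 1)
    (hS : S ∈ shadowAt M (4 + 2) 4 (Uq M (4 + 2) 4) G) (ha : (coloops M S).card = 1) :
    load2 M 4 G S ≤ cap2 M 4 G S := by
  set K := G.filter (fun y => y ∉ clF M (G.erase y)) with hKdef
  have hcol : coloops M S = K := coloops_eq_filter_of_card hS (by rw [ha, hk])
  have hSG : S ⊆ G := subset_of_mem_shadowAt hS
  have hcap0 : ∀ S', 0 ≤ capS M 4 G S' := capS_nonneg' hG (by omega)
  have hcap2 : 7 / 10 ≤ cap2 M 4 G S := by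
    have h1 := cap2_ge_capS_sub_L1 (M := M) (q := 4) (G := G) (S := S) (hcap0 S)
    rw [L1_eq_zero_of_coloops_eq_K hG hd hS hcol] at h1
    have h3 := seven_tenths_le_capS hd hk hSG
    linarith
  by_cases hex : ex2 M 4 G S = ∅
  · rw [load2_eq_zero_of_ex2_eq_empty hex]
    exact cap2_nonneg (hcap0 S)
  obtain ⟨B₀, hB₀⟩ := Finset.nonempty_iff_ne_empty.2 hex
  have hS6 : S.card = 6 := card_eq_six_of_mem_ex2_one hs hl hG hd hk hB₀
  have hex10 : (ex2 M 4 G S).card ≤ 10 := by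
    have := two_mul_card_ex2_le hG hS
    rw [ha] at this
    omega
  have hpair : ∀ B ∈ ex2 M 4 G S, B ∈ membersIn M (Uq M (4 + 2) 4) G ∧ coloops M S ⊆ B ∧ B ⊆ S ∧ (S \ B).card = 2 ∧
      S \ B ⊆ G \ clF M B ∧ B ∉ lay0 M 4 G := by
    intro B hB
    obtain ⟨hBm, hB0, hBS, hsub, hcard⟩ := mem_ex2_unpack hB
    exact ⟨hBm, fun e he => mem_of_mem_ex2_of_mem_coloops hG hS hB he, hBS, hcard, hsub, hB0⟩
  have hP : ∃ p ∈ G, p ∉ S :=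
    exists_mem_sdiff_of_card_sdiff_eq_two hG hd (hpair B₀ hB₀).1 (hpair B₀ hB₀).2.2.1 hSG (hpair B₀ hB₀).2.2.2.1
  have hcov : ∀ B ∈ ex2 M 4 G S, ∀ z z', S \ B = {z, z'} → z ≠ z' →
      S.erase z' ∈ shadowAt M (4 + 2) 4 (Uq M (4 + 2) 4) G ∧ z' ∈ nonColoops M S := by
    intro B hB z z' hPz hzz'
    refine ⟨erase_mem_shadowAt_of_pair hG hB hPz hzz', ?_⟩
    have hz' : z' ∈ S \ B := by rw [hPz]; exact Finset.mem_insert_of_mem (Finset.mem_singleton_self _)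
    exact mem_nonColoops.2 ⟨(Finset.mem_sdiff.1 hz').1, fun h => (Finset.mem_sdiff.1 hz').2 ((hpair B hB).2.1 h)⟩
  have hw2 : ∀ B ∈ ex2 M 4 G S, ∀ z z', S \ B = {z, z'} → z ≠ z' →
      w2 M 4 G B S = (loss M 4 G B z + loss M 4 G B z') / (((G \ clF M B).card : ℚ) - 1) := by
    intro B hB z z' hPz hzz'
    obtain ⟨-, -, hBS, hcard, hsub, hB0⟩ := hpair B hB
    unfold w2
    rw [if_pos ⟨hB0, hBS, hsub, hcard⟩, hPz, Finset.sum_pair hzz']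
  have hloss : ∀ B ∈ ex2 M 4 G S, ∀ z z', S \ B = {z, z'} → z ≠ z' → ∀ L : ℚ, L1 M 4 G (S.erase z') ≤ L →
      loss M 4 G B z ≤ req M 4 B * (if L ≤ 7 / 10 then (0 : ℚ) else (L - 7 / 10) / L) := by
    intro B hB z z' hPz hzz' L hL
    have hBS := (hpair B hB).2.2.1
    rw [erase_eq_insert_of_sdiff_pair hBS hPz hzz'] at hL
    have hz : z ∈ S \ B := by rw [hPz]; exact Finset.mem_insert_self _ _
    exact loss_le_req_mul_lossFracC (by norm_num) hL (seven_tenths_le_capS hd hk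
      (Finset.insert_subset (hSG (Finset.mem_sdiff.1 hz).1) (hBS.trans hSG)))
  -- at most two fat deletions at every covering set
  have htwo : ∀ v ∈ nonColoops M S,
      (((nonColoops M S).erase v).filter (fun t => (S.erase v).erase t ∈ membersIn M (Uq M (4 + 2) 4) G ∧
        G \ S ⊆ clF M ((S.erase v).erase t))).card ≤ 2 := by
    intro v hv
    by_contra hlt
    push Not at hlt
    obtain ⟨t₁, ht₁, t₂, ht₂, t₃, ht₃, h12, h13, h23⟩ := Finset.two_lt_card.1 hlt
    rw [Finset.mem_filter] at ht₁ ht₂ ht₃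
    have hps₁ := pair_shape_of_erase_erase' hv (Finset.mem_erase.1 ht₁.1).2 (Ne.symm (Finset.mem_erase.1 ht₁.1).1)
    have hps₂ := pair_shape_of_erase_erase' hv (Finset.mem_erase.1 ht₂.1).2 (Ne.symm (Finset.mem_erase.1 ht₂.1).1)
    have hps₃ := pair_shape_of_erase_erase' hv (Finset.mem_erase.1 ht₃.1).2 (Ne.symm (Finset.mem_erase.1 ht₃.1).1)
    have hne : ∀ {a b : α}, a ∈ (nonColoops M S).erase v → b ∈ (nonColoops M S).erase v → a ≠ b →
        (S.erase v).erase a ≠ (S.erase v).erase b := by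
      intro a b ha hb hab h
      have haS : a ∈ S.erase v := Finset.mem_erase.2 ⟨(Finset.mem_erase.1 ha).1, (mem_nonColoops.1 (Finset.mem_erase.1 ha).2).1⟩
      have hbS : b ∈ S.erase v := Finset.mem_erase.2 ⟨(Finset.mem_erase.1 hb).1, (mem_nonColoops.1 (Finset.mem_erase.1 hb).2).1⟩
      exact hab (Finset.erase_injOn (S.erase v) haS hbS h)
    exact not_three_fat_in_erase_one hs hl hG hk hS hS6 hcol hv hP hps₁.1 hps₂.1 hps₃.1
      (Finset.erase_subset _ _) (Finset.erase_subset _ _) (Finset.erase_subset _ _) hps₁.2.2 hps₂.2.2 hps₃.2.2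
      (hne ht₁.1 ht₂.1 h12) (hne ht₁.1 ht₃.1 h13) (hne ht₂.1 ht₃.1 h23) ht₁.2.2 ht₂.2.2 ht₃.2.2
  have hfrac22 : (if (22 / 25 : ℚ) ≤ 7 / 10 then (0 : ℚ) else (22 / 25 - 7 / 10) / (22 / 25)) = 9 / 44 := by norm_num
  -- the weight of a member
  have hw : ∀ B ∈ ex2 M 4 G S, w2 M 4 G B S ≤ 9 / 220 + (if G \ S ⊆ clF M B then (27 / 275 - 9 / 220 : ℚ) else 0) := by
    intro B hB
    obtain ⟨hBm, hcB, hBS, hcard, hsub, hB0⟩ := hpair B hB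
    obtain ⟨z, z', hzz', hPz⟩ := Finset.card_eq_two.1 hcard
    have hPz' : S \ B = {z', z} := by rw [hPz, Finset.pair_comm]
    rw [hw2 B hB z z' hPz hzz']
    obtain ⟨hSv, hv⟩ := hcov B hB z z' hPz hzz'
    obtain ⟨hSv', hv'⟩ := hcov B hB z' z hPz' hzz'.symm
    have hL := L1_erase_le_one_one hG hd hS hS6 ha hcol hv hSv (htwo z' hv)
    have hL' := L1_erase_le_one_one hG hd hS hS6 ha hcol hv' hSv' (htwo z hv')
    have hl1 := hloss B hB z z' hPz hzz' (22 / 25) (by push_cast at hL; linarith)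
    have hl2 := hloss B hB z' z hPz' hzz'.symm (22 / 25) (by push_cast at hL'; linarith)
    rw [hfrac22] at hl1 hl2
    have hm2 := (req_pair_le' hG hd hS hS6 hBm hcB hBS hcard).2.2.1
    by_cases hf : G \ S ⊆ clF M B
    · rw [if_pos hf]
      have hreq := (req_pair_le' hG hd hS hS6 hBm hcB hBS hcard).1
      have hden : (1 : ℚ) ≤ ((G \ clF M B).card : ℚ) - 1 := by
        have : (2 : ℚ) ≤ ((G \ clF M B).card : ℚ) := by exact_mod_cast hm2
        linarith
      have hnum : loss M 4 G B z + loss M 4 G B z' ≤ 27 / 275 := by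
        have : req M 4 B * (9 / 44) ≤ 6 / 25 * (9 / 44) := by nlinarith
        linarith
      calc (loss M 4 G B z + loss M 4 G B z') / (((G \ clF M B).card : ℚ) - 1)
          ≤ (27 / 275) / 1 := div_le_div₀ (by norm_num) hnum (by norm_num) hden
        _ = 9 / 220 + (27 / 275 - 9 / 220) := by norm_num
    · rw [if_neg hf, add_zero]
      have hreq := (req_pair_le' hG hd hS hS6 hBm hcB hBS hcard).2.1 hf
      have hm3 := (req_pair_le' hG hd hS hS6 hBm hcB hBS hcard).2.2.2 hf
      have hden : (2 : ℚ) ≤ ((G \ clF M B).card : ℚ) - 1 := by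
        have : (3 : ℚ) ≤ ((G \ clF M B).card : ℚ) := by exact_mod_cast hm3
        linarith
      have hnum : loss M 4 G B z + loss M 4 G B z' ≤ 9 / 110 := by
        have : req M 4 B * (9 / 44) ≤ 1 / 5 * (9 / 44) := by nlinarith
        linarith
      calc (loss M 4 G B z + loss M 4 G B z') / (((G \ clF M B).card : ℚ) - 1)
          ≤ (9 / 110) / 2 := div_le_div₀ (by norm_num) hnum (by norm_num) hden
        _ = 9 / 220 := by norm_num
  -- the double count: at most five fat members
  set F := (ex2 M 4 G S).filter (fun B => G \ S ⊆ clF M B) with hFdef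
  have hF5 : F.card ≤ 5 := by
    have hdc := two_mul_card_fat_eq S F (fun B hB => (hpair B (Finset.mem_filter.1 hB).1).2.2.2.1)
    have hterm : ∀ t ∈ S, (F.filter (fun B => t ∉ B)).card ≤ (if t ∈ K then 0 else 2) := by
      intro t htS
      split_ifs with htK
      · rw [Nat.le_zero, Finset.card_eq_zero, Finset.filter_eq_empty_iff]
        intro B hB h
        exact h ((hpair B (Finset.mem_filter.1 hB).1).2.1 (hcol ▸ htK))
      · have htn : t ∈ nonColoops M S := mem_nonColoops.2 ⟨htS, fun h => htK (hcol ▸ h)⟩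
        -- the fat members missing `t` are fat deletions `(S ∖ t) ∖ t'` at the covering set `S ∖ t`
        set D := ((nonColoops M S).erase t).filter (fun t' => (S.erase t).erase t' ∈ membersIn M (Uq M (4 + 2) 4) G ∧
          G \ S ⊆ clF M ((S.erase t).erase t')) with hDdef
        have hsub : F.filter (fun B => t ∉ B) ⊆ D.image (fun t' => (S.erase t).erase t') := by
          intro B hB
          rw [Finset.mem_filter, hFdef, Finset.mem_filter] at hB
          obtain ⟨⟨hBex, hBfat⟩, htB⟩ := hB
          obtain ⟨hBm, hcB, hBS, hcard, -, -⟩ := hpair B hBex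
          obtain ⟨a, b, hab, hP⟩ := Finset.card_eq_two.1 hcard
          have htP : t ∈ S \ B := Finset.mem_sdiff.2 ⟨htS, htB⟩
          -- the other point `t'`
          have hex' : ∃ t', t' ≠ t ∧ S \ B = {t, t'} := by
            rw [hP, Finset.mem_insert, Finset.mem_singleton] at htP
            rcases htP with rfl | rfl
            · exact ⟨b, hab.symm, hP⟩
            · exact ⟨a, hab, by rw [hP, Finset.pair_comm]⟩
          obtain ⟨t', ht't, hP'⟩ := hex'
          have ht'P : t' ∈ S \ B := by rw [hP']; exact Finset.mem_insert_of_mem (Finset.mem_singleton_self _)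
          have hBeq : B = (S.erase t).erase t' := by
            ext e
            rw [Finset.mem_erase, Finset.mem_erase]
            constructor
            · intro he
              refine ⟨fun h => (Finset.mem_sdiff.1 ht'P).2 (h ▸ he), fun h => htB (h ▸ he), hBS he⟩
            · rintro ⟨het', het, heS⟩
              by_contra heB
              have : e ∈ S \ B := Finset.mem_sdiff.2 ⟨heS, heB⟩
              rw [hP', Finset.mem_insert, Finset.mem_singleton] at this
              rcases this with h | h
              · exact het h
              · exact het' h
          rw [Finset.mem_image]
          refine ⟨t', ?_, hBeq.symm⟩
          rw [hDdef, Finset.mem_filter, Finset.mem_erase, ← hBeq]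
          exact ⟨⟨ht't, mem_nonColoops.2 ⟨(Finset.mem_sdiff.1 ht'P).1, fun h => (Finset.mem_sdiff.1 ht'P).2 (hcB h)⟩⟩,
            hBm, hBfat⟩
        exact ((Finset.card_le_card hsub).trans Finset.card_image_le).trans (htwo t htn)
    have hsum := Finset.sum_le_sum hterm
    rw [← hdc] at hsum
    have hsum' : ∑ t ∈ S, (if t ∈ K then (0 : ℕ) else 2) = 2 * (S \ K).card := by
      rw [Finset.sum_ite, Finset.sum_const_zero, zero_add, Finset.sum_const, smul_eq_mul, Finset.filter_not,
        Finset.filter_mem_eq_inter, Finset.inter_eq_right.2 (hcol ▸ coloops_subset_self S)]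
      ring
    have hSK : (S \ K).card = 5 := by
      have := Finset.card_sdiff_add_card_eq_card (hcol ▸ coloops_subset_self (M := M) S : K ⊆ S)
      have hKc : K.card = 1 := by unfold kColoops at hk; rw [← hKdef] at hk; exact hk
      omega
    rw [hsum', hSK] at hsum
    omega
  have hload : load2 M 4 G S ≤ ∑ B ∈ ex2 M 4 G S, (9 / 220 + (if G \ S ⊆ clF M B then (27 / 275 - 9 / 220 : ℚ) else 0)) := by
    unfold load2
    rw [← Finset.sum_filter_ne_zero]
    exact Finset.sum_le_sum (fun B hB => hw B hB)
  rw [Finset.sum_add_distrib, Finset.sum_const, Finset.sum_ite, Finset.sum_const_zero, add_zero,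
    Finset.sum_const, nsmul_eq_mul, nsmul_eq_mul] at hload
  have h5 : ((F.card : ℕ) : ℚ) ≤ 5 := by exact_mod_cast hF5
  have h10 : ((ex2 M 4 G S).card : ℚ) ≤ 10 := by exact_mod_cast hex10
  have h0 : (0 : ℚ) ≤ (((ex2 M 4 G S).filter (fun B => G \ S ⊆ clF M B)).card : ℚ) := Nat.cast_nonneg _
  rw [← hFdef] at hload h0
  calc load2 M 4 G S ≤ _ := hload
    _ ≤ 7 / 10 := by nlinarith
    _ ≤ cap2 M 4 G S := hcap2

end OneOne

end PercRepro.Shadow
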